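import Literature.Probability.Percolation.ArmSeparationOutEvents
import HarnessLib

/-!
# Slots, routing data and corridor events of the four-arm outer landing step

Topic `Literature/Probability/Percolation`; family `crit-perc` / near-critical percolation on `𝕋`.
A brick of the near-critical arm-separation theorem for four arms of alternating colours
(P. Nolin, *Near-critical percolation in two dimensions*, EJP 13 (2008), Thm. 11 for `j = 4`,
`σ = BWBW` [arXiv 0711.4948: Thm. 10]; H. Kesten, CMP 109 (1987), Lemmas 4–6), landing step of the
external extremities (Nolin 2008, §4.4, p. 12: "`P(Ã^{·/η'}) ≤ C₁(η') P(Ã̃^{·/η',I_{η'}}) ≤ C₁ C₂ P(Ã̃^{·/η'₀,I_{η'₀}})`",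
Prop. 12 (i)/(iii) and Lemma 13 [arXiv Prop. 11, Lemma 12]). This is the four-arm analogue of the
tree's `ArmSeparationOutSlots.lean` (parameters and routing) and `ArmSeparationOutEvents.lean`
(events, monotonicity, supports), for the landing pattern `0, 2, 3, 5` of
`ArmSeparationExtFourArmQ.lean`:

* the outer-rung parameters `OParams` of the tree are reused; eight ring roads
  `rL ℓ ∈ (2M + (2ℓ+1)μ, 2M + (2ℓ+1)μ + s]`, `ℓ < 8`, with spokes of length `LL ℓ` and approach tubes
  of width `WL ℓ`, and five candidate target rows `tgtRow4 c`, `c < 5`, on each landing side;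
* a **slot** `Slot4` (seven rows `Fin 7 → Fin 4 → ℕ` of data): for each of the four arms `e` (indexed by its landing side,
  `e = 0, 1, 2, 3` for the sides `0, 2, 3, 5`, colours open/closed/open/closed) the frame, scale
  index and tip-row window of its fenced tip, the choice of its target row, the level of its ring,
  and its arc (start and length on that ring); `slot4Finset P` — finitely many, a number depending
  on `M / k₀` and `K` only;
* the **routing predicate** `RouteOK` (decidable): distinct levels, the entry piece and the exit run
  on the arc, the arc off the spoke windows of the arms of the OTHER colour on higher levels and off
  their approach windows on lower levels, target rows off the tips of the other colour on their
  side, and tips of different colours on a common side in distant windows — exactly what makes the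
  supports of the open corridors disjoint from those of the closed ones (same-colour corridors may
  overlap: Nolin's Lemma 13 only separates the increasing from the decreasing events);
* the events: `armE P σ e` (the tiny-fenced outer arm of colour `col e` in the frame `fr e` with tip in
  the window), `corrE P σ e` (its corridor: beacon, spoke, arc, approach tube and target free space,
  read in the configuration `psiCfg σ e ω` — colour-read, and centrally reflected for the arms landing
  on the sides `3`, `5`, which are the sides `0`, `2` of `frameConfig 3`), their monotonicity, their
  supports `privE` / the shared support `osharedFin`, and locality (`determinedBy_corrE`,
  `determinedBy_armE`).

Everything here is proved; no named facts are introduced.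

## References

* P. Nolin, Near-critical percolation in two dimensions, *Electron. J. Probab.* 13 (2008), §4.2
  Def. 6–8, §4.3 Prop. 12, Lemma 13, §4.4 (arXiv 0711.4948: Def. 6–8, Prop. 11, Lemma 12, proof of
  Thm. 10, p. 12) [Nolin2008].
* H. Kesten, Scaling relations for 2D-percolation, *Comm. Math. Phys.* 109 (1987), Lemma 2, §2 [Kesten1987].

Tree: `OParams`, `OParams.Valid` (`ArmSeparationOutSlots/OutArith.lean`), `obcnEvent`, `ospokeEvent`,
`ospokeTube`, `oslotFrame`, `osharedFin`, `TrapFencedArm.congr'`, `TrapFencedArm.mapMono`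
(`ArmSeparationOutEvents.lean`, `ArmSeparationExtSlotEvents.lean`), `otgtV`, `otgtRow`
(`ArmSeparationOutMove.lean`), `frameConfig`, `frameIso`, `trapScale`, `piecePos`, `latIdx`,
`blockOff`, `thinRing`, `arc`, `eventAll`, `sitesAll`, `triStripFinset`, `DeterminedBy` API.
-/

noncomputable section

open Set MeasureTheory

namespace Literature.Probability.Percolation

open LatticeModels Tube

/-! ### Ring roads, spokes, approach tubes and target rows -/

namespace OParams

variable (P : OParams)

/-- radius of the ring road of level `ℓ`: the multiple of `s` in `(2M + (2ℓ+1)μ, 2M + (2ℓ+1)μ + s]` [folklore] -/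
def rL (ℓ : ℕ) : ℕ := P.s * ((2 * P.M + (2 * ℓ + 1) * P.μ) / P.s) + P.s
/-- chunks per side of the ring of level `ℓ` [folklore] -/
def nL (ℓ : ℕ) : ℕ := P.rL ℓ / P.s
/-- number of tubes of the ring of level `ℓ` [folklore] -/
def Gr (ℓ : ℕ) : ℕ := 12 * P.nL ℓ - 4
/-- length of a spoke reaching the ring of level `ℓ` [folklore] -/
def LL (ℓ : ℕ) : ℕ := (2 * ℓ + 1) * P.μ + 2 * P.s + 4 * P.e
/-- width of an approach tube leaving the ring of level `ℓ`: `rL ℓ - 2e + WL ℓ = N' + N'/16` [folklore] -/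
def WL (ℓ : ℕ) : ℕ := P.N' + P.N' / 16 + 2 * P.e - P.rL ℓ
/-- spacing of the candidate target rows (their danger zones are disjoint) [folklore] -/
def sp : ℕ := P.N' / 64 + 2 * P.μ + 16 * P.s + 1
/-- the `c`-th candidate target row, `c < 5`: `otgtRow N' false + c sp` [folklore] -/
def tgtRow4 (c : ℕ) : ℤ := otgtRow P.N' false + c * P.sp

variable {P}

/-- **The ring of level `ℓ < 8` of a valid rung**: radius in `(2M + (2ℓ+1)μ, 2M + (2ℓ+1)μ + s]`, a
multiple of `s = k₀`, at least one chunk, inside `Λ_{4M}` with room for the approach tube. [folklore] -/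
theorem Valid.ring_facts (hV : P.Valid) {ℓ : ℕ} (hℓ : ℓ < 8) :
    2 * P.M + (2 * ℓ + 1) * P.μ < P.rL ℓ ∧ P.rL ℓ ≤ 2 * P.M + (2 * ℓ + 1) * P.μ + P.s ∧ P.nL ℓ * P.s = P.rL ℓ ∧ 1 ≤ P.nL ℓ ∧
      P.rL ℓ + P.WL ℓ = P.N' + P.N' / 16 + 2 * P.e ∧ P.rL ℓ + 2 * P.e ≤ 4 * P.M ∧ P.Gr ℓ = 12 * P.nL ℓ - 4 ∧
      P.LL ℓ = (2 * ℓ + 1) * P.μ + 2 * P.s + 4 * P.e := by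
  obtain ⟨hs, -, he, -, hk₀, hμ, -, -, -, -, -, -, hN, -, -, -, hμM, -⟩ := hV.facts
  have hk : 1 ≤ P.k₀ := le_trans (by norm_num) hk₀
  have h1 : 2 * P.M + (2 * ℓ + 1) * P.μ < P.rL ℓ := by
    unfold OParams.rL; rw [hs]; exact (Nat.lt_div_mul_add hk).trans_eq (by ring)
  have h2 : P.rL ℓ ≤ 2 * P.M + (2 * ℓ + 1) * P.μ + P.s := by
    unfold OParams.rL; rw [hs]; have := Nat.div_mul_le_self (2 * P.M + (2 * ℓ + 1) * P.μ) P.k₀; rw [Nat.mul_comm]; omega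
  have h3 : P.nL ℓ * P.s = P.rL ℓ := by
    unfold OParams.nL OParams.rL
    rw [hs, show P.k₀ * ((2 * P.M + (2 * ℓ + 1) * P.μ) / P.k₀) + P.k₀ = P.k₀ * ((2 * P.M + (2 * ℓ + 1) * P.μ) / P.k₀ + 1) by ring,
      Nat.mul_div_cancel_left _ hk, mul_comm]
  have h4 : 1 ≤ P.nL ℓ := by
    refine Nat.pos_of_ne_zero fun h0 => ?_
    rw [h0, zero_mul] at h3; omega
  have hμ15 : (2 * ℓ + 1) * P.μ ≤ 15 * P.μ := Nat.mul_le_mul_right _ (by omega)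
  refine ⟨h1, h2, h3, h4, ?_, ?_, rfl, rfl⟩
  · unfold OParams.WL; omega
  · omega

/-- **The integer ring facts**, cast to `ℤ`. [folklore] -/
theorem Valid.ring_ifacts (hV : P.Valid) {ℓ : ℕ} (hℓ : ℓ < 8) :
    2 * (P.M : ℤ) + (2 * ℓ + 1) * P.μ < P.rL ℓ ∧ (P.rL ℓ : ℤ) ≤ 2 * P.M + (2 * ℓ + 1) * P.μ + P.s ∧
      ((P.nL ℓ : ℕ) : ℤ) * P.s = P.rL ℓ ∧ (P.rL ℓ : ℤ) - 2 * P.e + P.WL ℓ = P.N' + (P.N' / 16 : ℕ) ∧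
      (P.rL ℓ : ℤ) + 2 * P.e ≤ 4 * P.M ∧ (P.LL ℓ : ℤ) = (2 * ℓ + 1) * P.μ + 2 * P.s + 4 * P.e := by
  obtain ⟨h1, h2, h3, -, h5, h6, -, h8⟩ := hV.ring_facts hℓ
  refine ⟨by exact_mod_cast h1, by exact_mod_cast h2, by exact_mod_cast h3, ?_, by exact_mod_cast h6, by rw [h8]; push_cast; ring⟩
  have : (P.rL ℓ : ℤ) + P.WL ℓ = P.N' + (P.N' / 16 : ℕ) + 2 * P.e := by exact_mod_cast h5
  linarith

/-- **The candidate target rows of a valid rung** lie in the middle landing band: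
`-2M + N'/16 ≤ tgtRow4 c ≤ -M - N'/16` for `c < 5`, and consecutive rows are `sp` apart. [folklore] -/
theorem Valid.tgtRow4_mem (hV : P.Valid) {c : ℕ} (hc : c < 5) :
    -(2 * (P.M : ℤ)) + (4 * P.M / 16 : ℕ) ≤ P.tgtRow4 c ∧ P.tgtRow4 c ≤ -(P.M : ℤ) - (4 * P.M / 16 : ℕ) := by
  obtain ⟨hs, -, he, -, hk₀, hμ, -, -, -, -, -, -, hN, -, -, -, hμM, -⟩ := hV.facts
  have h := otgtRow_mem P.N' false
  rw [hN] at h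
  have hsp : (P.sp : ℤ) = (4 * P.M / 64 : ℕ) + 2 * P.μ + 16 * P.s + 1 := by unfold OParams.sp; rw [hN]; push_cast; ring
  have hc' : (c : ℤ) ≤ 4 := by exact_mod_cast Nat.le_of_lt_succ hc
  unfold tgtRow4
  rw [hN]
  have hM := hμM
  have h2 : ((4 * P.M / 2 : ℕ) : ℤ) = 2 * P.M := by omega
  have h4 : ((4 * P.M / 4 : ℕ) : ℤ) = P.M := by omega
  have hc0 : (0 : ℤ) ≤ (c : ℤ) * P.sp := by positivity
  have hc4 : (c : ℤ) * P.sp ≤ 4 * P.sp := by nlinarith [(show (0 : ℤ) ≤ P.sp from by positivity)]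
  constructor
  · linarith [h.1]
  · simp only [otgtRow, cond_false]
    omega

end OParams

/-! ### Slots -/

/-- **A slot of the four-arm outer landing step**: seven rows of data, one entry per arm `e`
(arms indexed by landing side: `e = 0, 1, 2, 3` land on the sides `0, 2, 3, 5`, colours
open/closed/open/closed): `0` frame of the tip, `1` scale index, `2` tip-row window, `3` target-row
choice, `4` level of the ring, `5` start and `6` length of the arc (positions on that ring, in the
arm's reading configuration). [cite: Nolin2008, §4.4 (arXiv 0711.4948: Thm. 10, external extremities)] -/
structure Slot4 where
  /-- the seven rows of data -/
  f : Fin 7 → Fin 4 → ℕ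

namespace Slot4

variable (P : OParams) (σ : Slot4)

/-- frame of the tip of the arm `e` [folklore] -/
def fr (e : Fin 4) : ℕ := σ.f 0 e
/-- scale index of the tip of the arm `e` [folklore] -/
def sc (e : Fin 4) : ℕ := σ.f 1 e
/-- window index of the tip row of the arm `e` [folklore] -/
def wi (e : Fin 4) : ℕ := σ.f 2 e
/-- target-row choice of the arm `e` [folklore] -/
def tc (e : Fin 4) : ℕ := σ.f 3 e
/-- level of the ring of the arm `e` [folklore] -/
def lv (e : Fin 4) : ℕ := σ.f 4 e
/-- start of the arc of the arm `e` [folklore] -/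
def ast (e : Fin 4) : ℕ := σ.f 5 e
/-- length of the arc of the arm `e` [folklore] -/
def aln (e : Fin 4) : ℕ := σ.f 6 e

/-- colour of the arm `e`: open for the sides `0`, `3` (`e = 0, 2`), closed for `2`, `5` (`e = 1, 3`) [folklore] -/
def col (e : Fin 4) : Bool := decide ((e : ℕ) % 2 = 0)
/-- base landing side in the reading configuration: `0` (open arms) or `2` (closed arms) [folklore] -/
def bs (e : Fin 4) : ℕ := if (e : ℕ) % 2 = 0 then 0 else 2
/-- absolute landing side of the arm `e`: `0, 2, 3, 5` [folklore] -/
def ts (e : Fin 4) : ℕ := if 2 ≤ (e : ℕ) then bs e + 3 else bs e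
/-- frame of the tip in the reading configuration (shifted by three for the reflected arms `e = 2, 3`) [folklore] -/
def fr' (e : Fin 4) : ℕ := if 2 ≤ (e : ℕ) then (σ.fr e + 3) % 6 else σ.fr e

/-- scale of the tip of the arm `e` [folklore] -/
def k (e : Fin 4) : ℕ := trapScale P.k₀ (σ.sc e)
/-- window start of the tip row of the arm `e` [folklore] -/
def T (e : Fin 4) : ℤ := P.T₀ (σ.wi e)
/-- lateral position of beacon and spoke of the arm `e` (in its frame) [folklore] -/
def ξ (e : Fin 4) : ℤ := σ.T P e + 2 * σ.k P e + P.w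
/-- ring radius of the arm `e` [folklore] -/
def r (e : Fin 4) : ℕ := P.rL (σ.lv e)
/-- chunks per side of the ring of the arm `e` [folklore] -/
def nr (e : Fin 4) : ℕ := P.nL (σ.lv e)
/-- number of tubes of the ring of the arm `e` [folklore] -/
def G (e : Fin 4) : ℕ := P.Gr (σ.lv e)
/-- spoke length of the arm `e` [folklore] -/
def L (e : Fin 4) : ℕ := P.LL (σ.lv e)
/-- approach width of the arm `e` [folklore] -/
def W (e : Fin 4) : ℕ := P.WL (σ.lv e)
/-- target row of the arm `e` (lateral coordinate in the frame of its landing side) [folklore] -/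
def t (e : Fin 4) : ℤ := P.tgtRow4 (σ.tc e)
/-- first lateral index of the exit run of the arm `e` [folklore] -/
def x (e : Fin 4) : ℕ := latIdx P.s (σ.r P e) (σ.t P e)
/-- shift between absolute ring positions and positions in the reading configuration (half a ring
for the reflected arms) [folklore] -/
def shift (e : Fin 4) : ℕ := if 2 ≤ (e : ℕ) then 6 * σ.nr P e - 2 else 0
/-- absolute position ↦ position in the reading configuration of the arm `e` [folklore] -/
def toView (e : Fin 4) (p : ℕ) : ℕ := (p + σ.G P e - σ.shift P e) % σ.G P e
/-- position (reading configuration) of the entry piece of the arm `e` on its ring [folklore] -/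
def pE (e : Fin 4) : ℕ := piecePos (σ.nr P e) (σ.fr' e) (latIdx P.s (σ.r P e) (σ.ξ P e))

end Slot4

/-- **Cyclic arc membership by position**: the position `p` lies on the arc of `len` tubes starting at
the position `a` of a ring of `G` tubes. [folklore] -/
def InArc (G a len p : ℕ) : Prop := (p + G - a) % G < len

/-- `InArc` is decidable. [folklore] -/
instance (G a len p : ℕ) : Decidable (InArc G a len p) := by unfold InArc; infer_instance

namespace Slot4

variable (P : OParams) (σ : Slot4)

/-- first position of the spoke window of the arm `b` on the ring of the arm `e` (absolute
positions: the pieces of lateral index `ι - 1, ι, ι + 1` of the side `fr b` and their connectors,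
`ι` the lateral index of the spoke of `b` on that ring) [folklore] -/
def spokeWinLo (b e : Fin 4) : ℕ :=
  blockOff (σ.nr P e) (σ.fr b) +
    (if σ.fr b % 3 = 2 then 2 * (σ.nr P e - 2 - latIdx P.s (σ.r P e) (σ.ξ P b)) else 2 * (latIdx P.s (σ.r P e) (σ.ξ P b) - 1))
/-- the approach window of the arm `b` on the ring of the arm `e` (absolute positions of the pieces of
the side `ts b` whose lateral indices cover the rows of the approach tube of `b`, with one index of
margin): first position [folklore] -/
def apprWinLo (b e : Fin 4) : ℕ :=
  min (piecePos (σ.nr P e) (ts b) (latIdx P.s (σ.r P e) (σ.t P b) - 1))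
    (piecePos (σ.nr P e) (ts b) (latIdx P.s (σ.r P e) (σ.t P b + (P.N' / 64 : ℕ)) + 1))
/-- the approach window: last position [folklore] -/
def apprWinHi (b e : Fin 4) : ℕ :=
  max (piecePos (σ.nr P e) (ts b) (latIdx P.s (σ.r P e) (σ.t P b) - 1))
    (piecePos (σ.nr P e) (ts b) (latIdx P.s (σ.r P e) (σ.t P b + (P.N' / 64 : ℕ)) + 1)) + 1
/-- the exit run of the arm `e` on its own ring (reading positions of the pieces `x e, …, x e + d` of
the side `bs e` and their connectors): first position [folklore] -/
def runLo (e : Fin 4) : ℕ := min (piecePos (σ.nr P e) (bs e) (σ.x P e)) (piecePos (σ.nr P e) (bs e) (σ.x P e + P.d))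
/-- the exit run: last position [folklore] -/
def runHi (e : Fin 4) : ℕ := max (piecePos (σ.nr P e) (bs e) (σ.x P e)) (piecePos (σ.nr P e) (bs e) (σ.x P e + P.d))

/-- **The routing predicate of a slot** (everything the landing needs besides the realised arms):
arcs inside their rings; distinct levels; the entry piece and the exit run on the arc; the arc of `e`
off the spoke windows of the other-colour arms of higher level and off their approach windows of lower
level; the target row of `e` off the danger zones of the other-colour tips sitting on its landing
side, and conversely the spoke of `e` off the approach rows of other-colour arms landing on its side;
tips of different colours on a common frame in distant windows. [cite: Nolin2008, §4.3 Lemma 13 and §4.4 (arXiv 0711.4948: Lemma 12; proof of Thm. 10, p. 12)] -/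
def RouteOK (P : OParams) (σ : Slot4) : Prop :=
  (∀ e : Fin 4, σ.ast e < σ.G P e ∧ 1 ≤ σ.aln e ∧ σ.aln e ≤ σ.G P e) ∧
  (∀ e b : Fin 4, e ≠ b → σ.lv e ≠ σ.lv b) ∧
  (∀ e : Fin 4, InArc (σ.G P e) (σ.ast e) (σ.aln e) (σ.pE P e)) ∧
  (∀ e : Fin 4, ∀ p : ℕ, p < σ.G P e → σ.runLo P e ≤ p → p ≤ σ.runHi P e → InArc (σ.G P e) (σ.ast e) (σ.aln e) p) ∧
  (∀ e b : Fin 4, col e ≠ col b → σ.lv e < σ.lv b →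
    ∀ q : ℕ, q < 6 → ¬ InArc (σ.G P e) (σ.ast e) (σ.aln e) (σ.toView P e (σ.spokeWinLo P b e + q))) ∧
  (∀ e b : Fin 4, col e ≠ col b → σ.lv b < σ.lv e →
    ∀ p : ℕ, p < 12 * σ.nr P e → σ.apprWinLo P b e ≤ p → p ≤ σ.apprWinHi P b e →
      ¬ InArc (σ.G P e) (σ.ast e) (σ.aln e) (σ.toView P e p)) ∧
  (∀ e b : Fin 4, col e ≠ col b → σ.fr e = ts b →
    σ.ξ P e + P.μ + 8 * P.s < σ.t P b ∨ σ.t P b + (P.N' / 64 : ℕ) + P.μ + 8 * P.s < σ.ξ P e) ∧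
  (∀ e b : Fin 4, col e ≠ col b → σ.fr e = σ.fr b →
    σ.T P e + 8 * σ.k P e < σ.T P b + P.w ∨ σ.T P b + 8 * σ.k P b < σ.T P e + P.w)

/-- The routing predicate is (classically) decidable. [folklore] -/
instance (P : OParams) (σ : Slot4) : Decidable (RouteOK P σ) := Classical.dec _

end Slot4

/-- **The finitely many slots**: frames `< 6`, scale indices `< K`, windows `< Nw`, target choices
`< 5`, levels `< 8`, arc starts `≤ GL 7` and lengths `≤ GL 7`. [folklore] -/
def slot4Bound (P : OParams) (q : Fin 7) : ℕ := (![6, P.K, P.Nw, 5, 8, P.Gr 7 + 1, P.Gr 7 + 1] : Fin 7 → ℕ) q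

/-- The data rows as a finset of functions. [folklore] -/
def slot4DataFinset (P : OParams) : Finset (Fin 7 → Fin 4 → ℕ) :=
  Fintype.piFinset fun q : Fin 7 => Fintype.piFinset fun _ : Fin 4 => Finset.range (slot4Bound P q)

/-- The slot finset. [folklore] -/
def slot4Finset (P : OParams) : Finset Slot4 :=
  (slot4DataFinset P).map ⟨Slot4.mk, fun _ _ h => Slot4.mk.inj h⟩

/-- Membership in the slot finset, unfolded. [folklore] -/
theorem mem_slot4Finset {P : OParams} {σ : Slot4} : σ ∈ slot4Finset P ↔ ∀ q e, σ.f q e < slot4Bound P q := by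
  unfold slot4Finset slot4DataFinset
  simp only [Finset.mem_map, Function.Embedding.coeFn_mk, Fintype.mem_piFinset, Finset.mem_range]
  constructor
  · rintro ⟨g, hg, rfl⟩; exact hg
  · intro h; exact ⟨σ.f, h, rfl⟩

/-- **The number of slots** is `∏_q (slot4Bound P q)^4`, a function of `K`, `Nw` and `Gr 7` only. [folklore] -/
theorem card_slot4Finset (P : OParams) : (slot4Finset P).card = ∏ q : Fin 7, slot4Bound P q ^ 4 := by
  unfold slot4Finset slot4DataFinset
  rw [Finset.card_map, Fintype.card_piFinset]
  refine Finset.prod_congr rfl fun q _ => ?_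
  rw [Fintype.card_piFinset, Finset.prod_const, Finset.card_range, Finset.card_univ, Fintype.card_fin]

/-! ### Colour-read and reflected configurations -/

/-- **The configuration read in colour `b`**: `ω` itself (`b = true`) or its complement (`b = false`). [folklore] -/
def colCfg (b : Bool) (ω : SiteConfig (Site 2)) : SiteConfig (Site 2) := {v | v ∈ ω ↔ b}

/-- Reading in colour `true`. [folklore] -/
@[simp] theorem colCfg_true (ω : SiteConfig (Site 2)) : colCfg true ω = ω := setOf_mem_iff_true ω

/-- Reading in colour `false`. [folklore] -/
@[simp] theorem colCfg_false (ω : SiteConfig (Site 2)) : colCfg false ω = ωᶜ := setOf_mem_iff_false ω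

/-- Membership in the colour-read configuration. [folklore] -/
theorem mem_colCfg {b : Bool} {ω : SiteConfig (Site 2)} {v : Site 2} : v ∈ colCfg b ω ↔ (v ∈ ω ↔ b) := Iff.rfl

/-- Framing commutes with colour reading. [folklore] -/
theorem frameConfig_colCfg (i : ℕ) (b : Bool) (ω : SiteConfig (Site 2)) :
    frameConfig i (colCfg b ω) = colCfg b (frameConfig i ω) := by
  ext v; rw [mem_frameConfig, mem_colCfg, mem_colCfg, mem_frameConfig]

/-- Colour reading in colour `true` is monotone. [folklore] -/
theorem colCfg_true_mono {ω ω' : SiteConfig (Site 2)} (h : ω ≤ ω') : colCfg true ω ≤ colCfg true ω' := by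
  rw [colCfg_true, colCfg_true]; exact h

/-- Colour reading in colour `false` is antitone. [folklore] -/
theorem colCfg_false_anti {ω ω' : SiteConfig (Site 2)} (h : ω ≤ ω') : colCfg false ω' ≤ colCfg false ω := by
  rw [colCfg_false, colCfg_false]; exact Set.compl_subset_compl.2 h

namespace Slot4

variable (P : OParams) (σ : Slot4)

/-- **The reading configuration of the arm `e`**: `ω` read in the colour of the arm, and centrally
reflected (`frameConfig 3`) for the arms landing on the sides `3`, `5`, so that every arm lands on
the side `bs e ∈ {0, 2}` of its reading configuration. [folklore] -/
def psiCfg (e : Fin 4) (ω : SiteConfig (Site 2)) : SiteConfig (Site 2) :=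
  if 2 ≤ (e : ℕ) then frameConfig 3 (colCfg (col e) ω) else colCfg (col e) ω

end Slot4

/-! ### The events -/

/-- **The outer corridor to the base side `bs`** (reading configuration): beacon, outer spoke, the arc,
and — read through the frame `bs` (`0`: identity; `2`: transposition) — the approach tube
`[r - 2e, N' + N'/16] × [t, t + N'/64]` crossed horizontally and the thinned target free space at
the landing row `t` crossed vertically. [cite: Nolin2008, §4.3 Prop. 12 (proof) (arXiv 0711.4948: Prop. 11)] -/
def ocorrEvent4 (i M k : ℕ) (T₀ : ℤ) (w L ε r e s a len bs : ℕ) (t : ℤ) (W N' : ℕ) : Set (SiteConfig (Site 2)) :=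
  obcnEvent i M k T₀ w ∩ ospokeEvent i M k T₀ w L ε ∩ eventAll (arc (thinRing r e s) a len) ∩
    {χ | frameConfig bs χ ∈ triHCross ((r : ℤ) - 2 * e) t W (N' / 64)} ∩ {χ | frameConfig bs χ ∈ otgtV N' t}

namespace Slot4

variable (P : OParams) (σ : Slot4)

/-- **The tiny-fenced outer arm of the arm slot `e`**: a fenced outer arm of colour `col e` of the frame
`fr e` (an open arm of `frameConfig (fr e) (colCfg (col e) ω)`) with a middle tip, at the scale index
`sc e`, with tip row in the window `wi e`. [cite: Nolin2008, §4.4 (arXiv 0711.4948: Thm. 10, external extremities)] -/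
def armE (e : Fin 4) : Set (SiteConfig (Site 2)) :=
  {ω | ∃ F : TrapFencedArm P.M P.n P.k₀ P.K (frameConfig (σ.fr e) (colCfg (col e) ω)),
    (-(2 * (P.M : ℤ)) + P.R₀ ≤ F.z 1 ∧ F.z 1 ≤ -(P.R₀ : ℤ)) ∧ F.j = σ.sc e ∧ σ.T P e ≤ F.z 1 ∧ F.z 1 < σ.T P e + P.w}

/-- **The corridor of the arm slot `e`**, read in its reading configuration. [cite: Nolin2008, §4.3 Prop. 12 (proof) (arXiv 0711.4948: Prop. 11)] -/
def corrE (e : Fin 4) : Set (SiteConfig (Site 2)) :=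
  {ω | psiCfg e ω ∈ ocorrEvent4 (σ.fr' e) P.M (σ.k P e) (σ.T P e) P.w (σ.L P e) P.ε (σ.r P e) P.e P.s (σ.ast e) (σ.aln e)
    (bs e) (σ.t P e) (σ.W P e) P.N'}

end Slot4

/-! ### Monotonicity -/

/-- The four-arm corridor event is increasing. [folklore] -/
theorem isUpperSet_ocorrEvent4 (i M k : ℕ) (T₀ : ℤ) (w L ε r e s a len bs : ℕ) (t : ℤ) (W N' : ℕ) :
    IsUpperSet (ocorrEvent4 i M k T₀ w L ε r e s a len bs t W N') :=
  ((((isUpperSet_obcnEvent i M k T₀ w).inter (isUpperSet_ospokeEvent i M k T₀ w L ε)).inter (isUpperSet_eventAll _)).inter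
    (isUpperSet_preimage_frameConfig bs (isUpperSet_triHCross _ _ _ _))).inter
    (isUpperSet_preimage_frameConfig bs (isUpperSet_triVCross _ _ _ _))

namespace Slot4

variable (P : OParams) (σ : Slot4)

/-- The reading configuration is monotone for open arms and antitone for closed arms. [folklore] -/
theorem psiCfg_mono_or_anti (e : Fin 4) {ω ω' : SiteConfig (Site 2)} (h : ω ≤ ω') :
    (col e = true → psiCfg e ω ≤ psiCfg e ω') ∧ (col e = false → psiCfg e ω' ≤ psiCfg e ω) := by
  unfold psiCfg
  constructor <;> intro hc <;> rw [hc] <;> split_ifs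
  · exact frameConfig_mono 3 (colCfg_true_mono h)
  · exact colCfg_true_mono h
  · exact frameConfig_mono 3 (colCfg_false_anti h)
  · exact colCfg_false_anti h

/-- **The corridor of an open arm is increasing.** [folklore] -/
theorem isUpperSet_corrE {e : Fin 4} (hc : col e = true) : IsUpperSet (σ.corrE P e) :=
  fun _ _ hle hω => isUpperSet_ocorrEvent4 _ _ _ _ _ _ _ _ _ _ _ _ _ _ _ _ ((psiCfg_mono_or_anti e hle).1 hc) hω

/-- **The corridor of a closed arm is decreasing.** [folklore] -/
theorem isLowerSet_corrE {e : Fin 4} (hc : col e = false) : IsLowerSet (σ.corrE P e) :=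
  fun _ _ hle hω => isUpperSet_ocorrEvent4 _ _ _ _ _ _ _ _ _ _ _ _ _ _ _ _ ((psiCfg_mono_or_anti e hle).2 hc) hω

/-- **The arm event of an open arm is increasing.** [folklore] -/
theorem isUpperSet_armE {e : Fin 4} (hc : col e = true) : IsUpperSet (σ.armE P e) := by
  intro ω ω' hle hω
  obtain ⟨F, hmid, hj, h1, h2⟩ := hω
  have hle' : frameConfig (σ.fr e) (colCfg (col e) ω) ≤ frameConfig (σ.fr e) (colCfg (col e) ω') := by
    rw [hc]; exact frameConfig_mono _ (colCfg_true_mono hle)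
  exact ⟨F.mapMono hle', hmid, hj, h1, h2⟩

/-- **The arm event of a closed arm is decreasing.** [folklore] -/
theorem isLowerSet_armE {e : Fin 4} (hc : col e = false) : IsLowerSet (σ.armE P e) := by
  intro ω ω' hle hω
  obtain ⟨F, hmid, hj, h1, h2⟩ := hω
  have hle' : frameConfig (σ.fr e) (colCfg (col e) ω) ≤ frameConfig (σ.fr e) (colCfg (col e) ω') := by
    rw [hc]; exact frameConfig_mono _ (colCfg_false_anti hle)
  exact ⟨F.mapMono hle', hmid, hj, h1, h2⟩

end Slot4

/-! ### Supports -/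

/-- **The support of a four-arm outer corridor**: `frameIso i` of the slot frame box and of the
spoke's box, the sites of the arc, and `frameIso bs` of the approach box and of the target box. [cite: Nolin2008, §4.3 Lemma 13 (arXiv 0711.4948: Lemma 12, the sets `𝒜^±`)] -/
def ocorrFin4 (i M k : ℕ) (T₀ : ℤ) (w L ε r e s a len bs : ℕ) (t : ℤ) (W N' : ℕ) : Finset (Site 2) :=
  (oslotFrame M k T₀ w ∪ (ospokeTube M k T₀ w L ε).sites).image (frameIso i) ∪ sitesAll (arc (thinRing r e s) a len) ∪
    (triStripFinset ((r : ℤ) - 2 * e) t W (N' / 64) ∪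
      triStripFinset ((N' : ℤ) + 1) (t - (N' / 64 : ℕ)) (N' / 16 - 1) (2 * (N' / 64))).image (frameIso bs)

/-- The support of a four-arm outer corridor, as a set. [folklore] -/
theorem coe_ocorrFin4 (i M k : ℕ) (T₀ : ℤ) (w L ε r e s a len bs : ℕ) (t : ℤ) (W N' : ℕ) :
    (↑(ocorrFin4 i M k T₀ w L ε r e s a len bs t W N') : Set (Site 2)) =
      frameIso i '' ((↑(oslotFrame M k T₀ w) : Set (Site 2)) ∪ (ospokeTube M k T₀ w L ε).box) ∪ boxAll (arc (thinRing r e s) a len) ∪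
        frameIso bs '' (triStrip ((r : ℤ) - 2 * e) t W (N' / 64) ∪ triStrip ((N' : ℤ) + 1) (t - (N' / 64 : ℕ)) (N' / 16 - 1) (2 * (N' / 64))) := by
  unfold ocorrFin4
  rw [Finset.coe_union, Finset.coe_union, Finset.coe_image, Finset.coe_image, Finset.coe_union, Finset.coe_union, coe_sites,
    coe_sitesAll, coe_triStripFinset, coe_triStripFinset]

/-- **The four-arm outer corridor event is determined by its support** (`2 ≤ k`). [folklore] -/
theorem determinedBy_ocorrEvent4 {i M k : ℕ} (hk : 2 ≤ k) (T₀ : ℤ) (w L ε r e s a len bs : ℕ) (t : ℤ) (W N' : ℕ) :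
    DeterminedBy (ocorrEvent4 i M k T₀ w L ε r e s a len bs t W N') ↑(ocorrFin4 i M k T₀ w L ε r e s a len bs t W N') := by
  unfold ocorrEvent4 otgtV
  rw [coe_ocorrFin4]
  have d1 : DeterminedBy (obcnEvent i M k T₀ w) (frameIso i '' ↑(triSqAnnulusFinset (obcnCentre M k T₀ w) (k / 2) (2 * (k / 2)))) :=
    determinedBy_preimage_frameConfig i (determinedBy_triFrameAt _ _)
  have d2 := determinedBy_ospokeEvent i M k T₀ w L ε
  have d3 := determinedBy_eventAll (arc (thinRing r e s) a len)
  have d4 := determinedBy_preimage_frameConfig bs (determinedBy_triHCross ((r : ℤ) - 2 * e) t W (N' / 64))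
  have d5 := determinedBy_preimage_frameConfig bs (determinedBy_triVCross ((N' : ℤ) + 1) (t - (N' / 64 : ℕ)) (N' / 16 - 1) (2 * (N' / 64)))
  rw [coe_triStripFinset] at d4 d5
  rw [coe_sitesAll] at d3
  refine ((((d1.mono ?_).inter (d2.mono ?_)).inter (d3.mono ?_)).inter (d4.mono ?_)).inter (d5.mono ?_)
  · rintro v ⟨u, hu, rfl⟩
    exact Or.inl (Or.inl ⟨u, Or.inl (triSqAnnulusFinset_obcn_subset_oslotFrame hk T₀ w hu), rfl⟩)
  · rintro v ⟨u, hu, rfl⟩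
    exact Or.inl (Or.inl ⟨u, Or.inr hu, rfl⟩)
  · intro v hv; exact Or.inl (Or.inr hv)
  · rintro v ⟨u, hu, rfl⟩; exact Or.inr ⟨u, Or.inl hu, rfl⟩
  · rintro v ⟨u, hu, rfl⟩; exact Or.inr ⟨u, Or.inr hu, rfl⟩

/-- The map between reading positions and absolute positions of sites: the identity for the arms
`e = 0, 1`, the central symmetry for the reflected arms `e = 2, 3`. [folklore] -/
def viewMap (e : Fin 4) (v : Site 2) : Site 2 := if 2 ≤ (e : ℕ) then -v else v

/-- `viewMap e` is an involution. [folklore] -/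
theorem viewMap_viewMap (e : Fin 4) (v : Site 2) : viewMap e (viewMap e v) = v := by
  unfold viewMap; split_ifs <;> simp

namespace Slot4

variable (P : OParams) (σ : Slot4)

/-- **The private support of the arm slot `e`** (absolute sites): the image under `viewMap e` of the
support of its corridor in the reading configuration. [cite: Nolin2008, §4.3 Lemma 13 (arXiv 0711.4948: Lemma 12)] -/
def privE (e : Fin 4) : Finset (Site 2) :=
  (ocorrFin4 (σ.fr' e) P.M (σ.k P e) (σ.T P e) P.w (σ.L P e) P.ε (σ.r P e) P.e P.s (σ.ast e) (σ.aln e) (bs e) (σ.t P e) (σ.W P e)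
    P.N').image (viewMap e)

variable {P σ}

/-- A preimage under the reading map `psiCfg e` of an event determined by `S` is determined by
`viewMap e '' S`. [folklore] -/
theorem determinedBy_preimage_psiCfg (e : Fin 4) {E : Set (SiteConfig (Site 2))} {S : Set (Site 2)} (hE : DeterminedBy E S) :
    DeterminedBy {ω : SiteConfig (Site 2) | psiCfg e ω ∈ E} (viewMap e '' S) := by
  unfold psiCfg
  by_cases h2 : 2 ≤ (e : ℕ)
  · simp only [if_pos h2]
    have h := determinedBy_preimage_colour (col e) (determinedBy_preimage_frameConfig 3 hE)
    refine h.mono ?_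
    rintro v ⟨u, hu, rfl⟩
    refine ⟨u, hu, ?_⟩
    unfold viewMap; rw [if_pos h2]
    exact (triNegIso_apply u).symm
  · simp only [if_neg h2]
    have h := determinedBy_preimage_colour (col e) hE
    refine h.mono ?_
    intro v hv
    exact ⟨v, hv, by unfold viewMap; rw [if_neg h2]⟩

/-- **The corridor of the arm slot `e` is determined by its private support** (`2 ≤ k₀`). [folklore] -/
theorem determinedBy_corrE (hk : 2 ≤ P.k₀) (e : Fin 4) : DeterminedBy (σ.corrE P e) ↑(σ.privE P e) := by
  unfold corrE privE
  rw [Finset.coe_image]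
  exact determinedBy_preimage_psiCfg e (determinedBy_ocorrEvent4 (i := σ.fr' e) (M := P.M) (k := σ.k P e)
    (le_trans hk (le_trapScale _ _)) _ _ _ _ _ _ _ _ _ _ _ _ _)

/-- **Agreement on the shared support and on the framed slot box transports the arm of a slot**
(valid rung, `fr e < 6`). [folklore] -/
theorem armE_of_agree (hV : P.Valid) {e : Fin 4} (hfr : σ.fr e < 6) {ω ω' : SiteConfig (Site 2)}
    (h : ∀ v ∈ (↑(osharedFin P.n P.M) : Set (Site 2)) ∪ frameIso (σ.fr e) '' ↑(oslotFrame P.M (σ.k P e) (σ.T P e) P.w), v ∈ ω ↔ v ∈ ω')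
    (hω : ω ∈ σ.armE P e) : ω' ∈ σ.armE P e := by
  obtain ⟨hs, hk₀, hμ, hw1, hw2, -, -, -, -, -, -, -, -, -, -, -, -, -, hn, hμM, hR₀, hR₀M, -⟩ := hV.ifacts
  obtain ⟨F, hmid, hj, h1, h2⟩ := hω
  have hko : F.k = σ.k P e := by show trapScale P.k₀ F.j = trapScale P.k₀ (σ.sc e); rw [hj]
  have hk1 : 1 ≤ F.k := hko ▸ one_le_trapScale (by omega) _
  have hk32 : 32 * (F.k : ℤ) ≤ P.μ := by rw [hko]; exact_mod_cast P.scale_le (hj ▸ F.j_lt)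
  obtain ⟨hz0, hz1, hz2⟩ := trapO_coord F.z_mem
  have hnM : P.n ≤ P.M := hV.hn
  refine ⟨F.congr' hnM fun u hu => ?_, hmid, hj, h1, h2⟩
  -- agreement on the frame sites
  rw [mem_frameConfig, mem_frameConfig, mem_colCfg, mem_colCfg]
  suffices hiff : frameIso (σ.fr e) u ∈ ω ↔ frameIso (σ.fr e) u ∈ ω' by rw [hiff]
  apply h
  rcases hu with (hu | hu) | hu
  · left
    rw [mem_triAnnSet] at hu
    rw [Finset.mem_coe, mem_osharedFin, triNorm_frameIso (σ.fr e) hfr]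
    push_cast at hu
    exact hu
  · rw [mem_trapFrameZone] at hu
    obtain ⟨hu1, hu2, hu3, hu4, hu5⟩ := hu
    rcases hu1 with hu1 | ⟨hu1, hu1'⟩
    · left
      have := trapD_subset_triAnnSet hnM (Finset.mem_coe.2 hu1)
      rw [mem_triAnnSet] at this
      rw [Finset.mem_coe, mem_osharedFin, triNorm_frameIso (σ.fr e) hfr]
      push_cast at this
      exact this
    · right
      refine ⟨u, ?_, rfl⟩
      have hn := lt_triNorm_iff_lin.1 hu1
      rw [Finset.mem_coe, mem_oslotFrame (show 1 ≤ σ.k P e from hko ▸ hk1), ← hko]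
      omega
  · right
    refine ⟨u, ?_, rfl⟩
    rw [mem_triStrip] at hu
    rw [Finset.mem_coe, mem_oslotFrame (show 1 ≤ σ.k P e from hko ▸ hk1), ← hko]
    omega

/-- **The arm event of a slot is determined by the shared support and the framed slot box.** [cite: Nolin2008, §4.3 Lemma 13 (arXiv 0711.4948: Lemma 12)] -/
theorem determinedBy_armE (hV : P.Valid) {e : Fin 4} (hfr : σ.fr e < 6) :
    DeterminedBy (σ.armE P e) ((↑(osharedFin P.n P.M) : Set (Site 2)) ∪ frameIso (σ.fr e) '' ↑(oslotFrame P.M (σ.k P e) (σ.T P e) P.w)) := by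
  rw [determinedBy_iff]
  intro ω ω' hω
  have h : ∀ v ∈ (↑(osharedFin P.n P.M) : Set (Site 2)) ∪ frameIso (σ.fr e) '' ↑(oslotFrame P.M (σ.k P e) (σ.T P e) P.w), v ∈ ω ↔ v ∈ ω' :=
    fun v hv => by
      constructor
      · intro hvω; have : v ∈ ω ∩ _ := ⟨hvω, hv⟩; rw [hω] at this; exact this.1
      · intro hvω; have : v ∈ ω' ∩ _ := ⟨hvω, hv⟩; rw [← hω] at this; exact this.1
  exact ⟨armE_of_agree hV hfr h, armE_of_agree hV hfr fun v hv => (h v hv).symm⟩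

/-- The framed slot box of the arm `e` lies in its private support. [folklore] -/
theorem image_oslotFrame_subset_privE {e : Fin 4} (hfr : σ.fr e < 6) :
    frameIso (σ.fr e) '' (↑(oslotFrame P.M (σ.k P e) (σ.T P e) P.w) : Set (Site 2)) ⊆ ↑(σ.privE P e) := by
  rintro v ⟨u, hu, rfl⟩
  unfold privE
  rw [Finset.coe_image, coe_ocorrFin4]
  refine ⟨viewMap e (frameIso (σ.fr e) u), Or.inl (Or.inl ⟨u, Or.inl hu, ?_⟩), viewMap_viewMap e _⟩
  unfold viewMap Slot4.fr'
  by_cases h2 : 2 ≤ (e : ℕ)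
  · rw [if_pos h2, if_pos h2, frameIso_add_three hfr]
  · rw [if_neg h2, if_neg h2]

end Slot4

/-! ### The measure of the events read through `psiCfg` -/

/-- **`P_p` through the reading map**: `P_p(psiCfg e ⁻¹' E) = P_q(E)` with `q = p` for the open arms
and `q = 1 - p` for the closed arms (lattice symmetry and colour exchange). [cite: SmirnovWernerMRL2001, Rem. 2] -/
theorem real_preimage_psiCfg (p : unitInterval) (e : Fin 4) (E : Set (SiteConfig (Site 2))) :
    (triSitePercolation p).real {ω | Slot4.psiCfg e ω ∈ E} =
      (triSitePercolation (if Slot4.col e then p else unitInterval.symm p)).real E := by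
  have hcol : ∀ (q : unitInterval) (F : Set (SiteConfig (Site 2))),
      (triSitePercolation q).real {ω | colCfg (Slot4.col e) ω ∈ F} =
        (triSitePercolation (if Slot4.col e then q else unitInterval.symm q)).real F := by
    intro q F
    cases Slot4.col e
    · simp only [colCfg_false, Bool.false_eq_true, if_false]
      exact sitePercolation_real_preimage_compl q F
    · simp only [colCfg_true, if_true]; rfl
  unfold Slot4.psiCfg
  by_cases h2 : 2 ≤ (e : ℕ)
  · simp only [if_pos h2]
    have : {ω : SiteConfig (Site 2) | frameConfig 3 (colCfg (Slot4.col e) ω) ∈ E} =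
        {ω | colCfg (Slot4.col e) ω ∈ frameConfig 3 ⁻¹' E} := rfl
    rw [this, hcol, real_preimage_frameConfig]
  · simp only [if_neg h2]
    exact hcol p E

end Literature.Probability.Percolation
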